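import Literature.NumberTheory.PAdicHodge.BdRPlusRamifiedLogEvalContinuity
import Literature.NumberTheory.PAdicHodge.AinfRamifiedVarpi
import Literature.NumberTheory.PAdicHodge.AinfRamifiedTopology
import HarnessLib

/-!
# Ramified `p`-adic evaluation: the series in `Xᵖ` (re-indexing) and `(ϖ, ω_𝒪)`-closeness of points from a `θ_𝒪`-congruence modulo `ϖ`

Topic `Literature/NumberTheory/PAdicHodge`; namespaces `Literature.NumberTheory.PAdicHodge.AinfRam` (§1) and `…AinfRamTop` (§2). THEOREMS ONLY (no definition, no
named fact, no instance, no `sorry`). Two small supplements to the ramified evaluation layer `BdRPlusRamifiedLogEval{,Continuity,Add,Tower}`: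
* §1 ★ `partialSum_expand_eq` — for numerators `β` and the «expanded» numerators `β⁽ᵖ⁾ₙ = p·β_{n/p}` (`p ∣ n`), `= 0` (`p ∤ n`) — the numerators of
  `G(Xᵖ)` when `β` are those of `G` — the partial sums satisfy **`S_M(β⁽ᵖ⁾, y) = S_{⌊M/p⌋}(β, yᵖ)`** EXACTLY; hence `value_expand_of_value_pow`: a value of the
  `β`-series at `yᵖ` is a value of the `β⁽ᵖ⁾`-series at `y` (e.g. `ev(log_{E₀}(Xᵖ), y) = ev(log_{E₀}, yᵖ)`, the second coordinate of the Hodge line);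
* §2 ★ `sub_mem_span_varpi_omega_of_norm_theta_sub_le` — **if `‖θ_𝒪(a) − θ_𝒪(b)‖ ≤ ‖ϖ‖` then `a − b ∈ (ϖ, ω_𝒪)A_inf(𝒪)`** (`θ_𝒪` surjective, `ker θ_𝒪 = (ω_𝒪)`,
  `p ∈ (ϖ)`): the hypothesis of the UNIFORM continuity estimate `exists_pow_mul_partialSum_add_sub_partialSum_eq` read off θ-values; with
  `norm_pow_sub_pow_le_of_le` (`‖aᵖ − bᵖ‖ ≤ ‖a − b‖` on the unit ball) for the Frobenius-twisted points.
Purpose: in the Hodge-line identity the level-`n` points `[w̃⁽ⁿ⁾]`, `φ[w̃⁽ⁿ⁾]`, `[τ̃⁽ⁿ⁾]_𝒪` of the transported / twisted / original towers have θ-values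
`wₙ`, `≡ wₙᵖ (mod p)`, `τₙ` with `‖wₙ − τₙ‖ ≤ ‖ϖ‖` (CM-fibre transport) — so they are `(ϖ, ω_𝒪)`-close (crux K★ `stmt-BirchSwinnertonDyer-22226`, line `kato_lever`,
memo `Lines/kato-lever-K2-hne-direct-omega.md` §1, F3b). Infrastructure only: BSD / K★ are not proved by any of this.

## References
* J.-M. Fontaine, *Le corps des périodes p-adiques*, Astérisque 223 (1994), Exp. II §1.2.2, §1.5.3. [FontaineAsterisque223III]
* J.-M. Fontaine, *Formes différentielles et modules de Tate…*, Invent. Math. 65 (1982), §5. [Fontaine1982FormesDifferentielles]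
* L. Fargues, J.-M. Fontaine, *Courbes et fibrés vectoriels en théorie de Hodge p-adique*, Astérisque 406 (2018), §2.2. [FarguesFontaine2018]
-/

noncomputable section

namespace Literature.NumberTheory.PAdicHodge

/-! ## §1 The series in `Xᵖ` -/

namespace AinfRam

open ValuativeRel Field Ideal WittVector Finset
open Literature.NumberTheory.GaloisRepresentations Literature.NumberTheory.GaloisRepresentations.IsNonarchimedeanLocalField
open GaloisContinuity Literature.RingTheory.FormalGroups

variable {F : Type} [Field F] [ValuativeRel F] [TopologicalSpace F] [IsNonarchimedeanLocalField F]
  [CharZero F] {p : ℕ} [Fact p.Prime] [Fact (¬ IsUnit (p : integerC F))]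
  [IsAdicComplete (Ideal.span {(p : integerC F)}) (integerC F)]
  {hp : valuation F p < 1} (D : EisensteinRoot F p hp) (hθ : Function.Surjective (fontaineTheta (integerC F) p))

set_option maxHeartbeats 3200000 in
/-- ★ **Re-indexing: `S_M(β⁽ᵖ⁾, y) = S_{⌊M/p⌋}(β, yᵖ)`** for the expanded numerators `β⁽ᵖ⁾ₙ = p·β_{n/p}` (`p ∣ n`), `0` (`p ∤ n`).
[cite: Fontaine1982FormesDifferentielles, §5] -/
theorem partialSum_expand_eq (β : ℕ → D.Coeff) (y : AinfRam D) (M : ℕ) :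
    (∑ m ∈ Finset.range M, qpToBdR (((m + 1 : ℕ) : ℚ_[p])⁻¹) *
      toBdR D hθ (coeffHom D (if p ∣ m + 1 then (p : D.Coeff) * β ((m + 1) / p) else 0) * y ^ (m + 1))) =
      ∑ m ∈ Finset.range (M / p), qpToBdR (((m + 1 : ℕ) : ℚ_[p])⁻¹) * toBdR D hθ (coeffHom D (β (m + 1)) * (y ^ p) ^ (m + 1)) := by
  have hp1 : 1 < p := (Fact.out : p.Prime).one_lt
  have hp0 : (p : ℚ_[p]) ≠ 0 := Nat.cast_ne_zero.2 (Fact.out : p.Prime).ne_zero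
  induction M with
  | zero => rw [Nat.zero_div, Finset.sum_range_zero, Finset.sum_range_zero]
  | succ M ih =>
    rw [Finset.sum_range_succ, ih]
    by_cases hdvd : p ∣ M + 1
    · -- `M + 1 = p·q`, `(M+1)/p = M/p + 1`
      rw [if_pos hdvd, Nat.succ_div_of_dvd hdvd, Finset.sum_range_succ]
      congr 1
      obtain ⟨q, hq⟩ := hdvd
      have hpq : (M + 1) / p = q := by rw [hq, Nat.mul_div_cancel_left _ (Fact.out : p.Prime).pos]
      have hq1 : M / p + 1 = q := by rw [← hpq, Nat.succ_div_of_dvd ⟨q, hq⟩]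
      have hq0 : (q : ℚ_[p]) ≠ 0 := by
        have : q ≠ 0 := by rintro rfl; rw [mul_zero] at hq; exact Nat.succ_ne_zero M hq
        exact Nat.cast_ne_zero.2 this
      rw [hq1, hq, pow_mul]
      have hT : toBdR D hθ (coeffHom D ((p : D.Coeff) * β q) * (y ^ p) ^ q) =
          (p : BDeRhamPlus (integerC F) p) * toBdR D hθ (coeffHom D (β q) * (y ^ p) ^ q) := by
        rw [map_mul (coeffHom D), map_natCast, mul_assoc, map_mul (toBdR D hθ), map_natCast]
      rw [hT, ← mul_assoc, ← map_natCast (qpToBdR (F := F) (p := p)) p, ← map_mul, Nat.cast_mul,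
        show ((p : ℚ_[p]) * (q : ℚ_[p]))⁻¹ * (p : ℚ_[p]) = (q : ℚ_[p])⁻¹ by field_simp]
    · rw [if_neg hdvd, Nat.succ_div_of_not_dvd hdvd, map_zero, zero_mul, map_zero, mul_zero, add_zero]

/-- ★ **A value of the `β`-series at `yᵖ` is a value of the `β⁽ᵖ⁾`-series at `y`** (modulo `Fil^k`, same `L`). [cite: Fontaine1982FormesDifferentielles, §5] -/
theorem value_expand_of_value_pow {k : ℕ} (β : ℕ → D.Coeff) (y : AinfRam D) {L : BDeRhamPlus (integerC F) p}
    (hL : ∀ j : ℕ, ∃ M₀ : ℕ, ∀ M : ℕ, M₀ ≤ M → ∃ (a : Ainf (p := p) F) (w : BDeRhamPlus (integerC F) p),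
      L - (∑ m ∈ Finset.range M, qpToBdR (((m + 1 : ℕ) : ℚ_[p])⁻¹) * toBdR D hθ (coeffHom D (β (m + 1)) * (y ^ p) ^ (m + 1))) =
        ainfToBdR ((p : Ainf (p := p) F) ^ j * a) + xiBdR ^ k * w) :
    ∀ j : ℕ, ∃ M₀ : ℕ, ∀ M : ℕ, M₀ ≤ M → ∃ (a : Ainf (p := p) F) (w : BDeRhamPlus (integerC F) p),
      L - (∑ m ∈ Finset.range M, qpToBdR (((m + 1 : ℕ) : ℚ_[p])⁻¹) *
        toBdR D hθ (coeffHom D (if p ∣ m + 1 then (p : D.Coeff) * β ((m + 1) / p) else 0) * y ^ (m + 1))) =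
        ainfToBdR ((p : Ainf (p := p) F) ^ j * a) + xiBdR ^ k * w := by
  intro j
  obtain ⟨M₀, hM₀⟩ := hL j
  refine ⟨p * M₀, fun M hM => ?_⟩
  rw [partialSum_expand_eq]
  exact hM₀ (M / p) ((Nat.le_div_iff_mul_le (Fact.out : p.Prime).pos).2 (by rw [mul_comm]; exact hM))

end AinfRam

/-! ## §2 `(ϖ, ω_𝒪)`-closeness from a θ-congruence modulo `ϖ` -/

namespace AinfRamTop

open Ideal ValuativeRel Field WittVector
open Literature.NumberTheory.GaloisRepresentations Literature.NumberTheory.GaloisRepresentations.IsNonarchimedeanLocalField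
open Literature.NumberTheory.GaloisRepresentations.LubinTate

variable {F : Type} [Field F] [ValuativeRel F] [TopologicalSpace F] [IsNonarchimedeanLocalField F] [CharZero F]
  {p : ℕ} [Fact p.Prime] [Fact (¬ IsUnit (p : integerC F))] [IsAdicComplete (Ideal.span {(p : integerC F)}) (integerC F)]
  {hp : valuation F p < 1} {D : EisensteinRoot F p hp}

omit [CharZero F] [Fact (¬ IsUnit (p : integerC F))] [IsAdicComplete (Ideal.span {(p : integerC F)}) (integerC F)] in
/-- **`‖aᵈ − bᵈ‖ ≤ ‖a − b‖`** for `‖a‖, ‖b‖ ≤ 1` in `ℂ_F` (`a − b ∣ aᵈ − bᵈ` with an integral quotient). [cite: CasselsFrohlichANT1967, Ch. VI §3.2] -/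
theorem norm_pow_sub_pow_le_of_le {a b : CompletedAlgClosure F} (ha : ‖a‖ ≤ 1) (hb : ‖b‖ ≤ 1) (d : ℕ) : ‖a ^ d - b ^ d‖ ≤ ‖a - b‖ := by
  obtain ⟨c, hc⟩ := sub_dvd_pow_sub_pow a b d
  -- the quotient `c = Σ a^i b^{d-1-i}` has norm `≤ 1`
  have hgeom : a ^ d - b ^ d = (∑ i ∈ Finset.range d, a ^ i * b ^ (d - 1 - i)) * (a - b) := (Commute.all a b).geom_sum₂_mul d |>.symm
  rw [hgeom, norm_mul]
  refine mul_le_of_le_one_left (norm_nonneg _) ?_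
  refine IsUltrametricDist.norm_sum_le_of_forall_le_of_nonneg zero_le_one fun i _ => ?_
  rw [norm_mul, norm_pow, norm_pow]
  exact mul_le_one₀ (pow_le_one₀ (norm_nonneg _) ha) (pow_nonneg (norm_nonneg _) _) (pow_le_one₀ (norm_nonneg _) hb)

/-- ★ **`‖θ_𝒪(a) − θ_𝒪(b)‖ ≤ ‖ϖ‖ ⟹ a − b ∈ (ϖ, ω_𝒪)A_inf(𝒪)`** (read through `of : AinfRam D ≃ AinfRamTop D`): a θ-congruence modulo `ϖ𝒪_ℂ` lifts to the ideal
`(ϖ, ω_𝒪)` since `θ_𝒪` is onto `𝒪_ℂ`, `ker θ_𝒪 = (ω_𝒪)` and `p ∈ (ϖ)`. [cite: FontaineAsterisque223III, Exp. II §1.2.2] [cite: FarguesFontaine2018, §2.2] -/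
theorem sub_mem_span_varpi_omega_of_norm_theta_sub_le (hθ : Function.Surjective (fontaineTheta (integerC F) p)) {a b : AinfRamTop D}
    (h : ‖((theta D a : CBall F) : CompletedAlgClosure F) - ((theta D b : CBall F) : CompletedAlgClosure F)‖ ≤
      ‖((D.rootC : integerC F) : CompletedAlgClosure F)‖) :
    (of D).symm a - (of D).symm b ∈ Ideal.span {AinfRam.varpi D, AinfRam.omega D} := by
  have hϖ0 : ((D.rootC : integerC F) : CompletedAlgClosure F) ≠ 0 := by
    intro h0
    have h1 := D.norm_rootC_pow
    rw [h0, norm_zero, zero_pow (ne_of_gt D.e_pos)] at h1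
    exact (norm_pos_iff.2 (natCast_C_ne_zero (F := F) (Fact.out : p.Prime).ne_zero)).ne' h1.symm
  -- `θ(a − b) = ϖ · c'` with `c' ∈ 𝒪_ℂ`
  set c : CompletedAlgClosure F := ((theta D (a - b) : CBall F) : CompletedAlgClosure F) with hc
  have hcab : c = ((theta D a : CBall F) : CompletedAlgClosure F) - ((theta D b : CBall F) : CompletedAlgClosure F) := by
    rw [hc, map_sub]; rfl
  have hc' : ‖c / ((D.rootC : integerC F) : CompletedAlgClosure F)‖ ≤ 1 := by
    rw [norm_div, div_le_one (norm_pos_iff.2 hϖ0), hcab]; exact h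
  obtain ⟨x, hx⟩ := theta_surjective (D := D) hθ ⟨c / ((D.rootC : integerC F) : CompletedAlgClosure F), (LubinTate.mem_unitBall_iff _).2 hc'⟩
  -- `θ(a − b) = θ(ϖ · x)`, so `a − b − ϖ x ∈ 𝔦 = (p, ω)`
  have hθeq : theta D (a - b) = theta D (of D (AinfRam.varpi D) * x) := by
    apply Subtype.ext
    rw [map_mul, hx]
    change c = ((theta D (of D (AinfRam.varpi D)) : CBall F) : CompletedAlgClosure F) * (c / ((D.rootC : integerC F) : CompletedAlgClosure F))
    rw [coe_theta, AinfRam.theta_varpi, mul_div_cancel₀ _ hϖ0]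
  have hmem := sub_mem_ideal_of_theta_eq hθeq
  rw [ideal_eq] at hmem
  obtain ⟨s, t, hst⟩ := Ideal.mem_span_pair.1 hmem
  -- read in `AinfRam D`: `a − b = ϖ x + s p + t ω`, and `p ∈ (ϖ)`
  obtain ⟨q, hq⟩ := AinfRam.varpi_dvd_natCast D (p := p)
  have hab : (of D).symm a - (of D).symm b =
      AinfRam.varpi D * ((of D).symm x + q * (of D).symm s) + AinfRam.omega D * (of D).symm t := by
    have h1 := congrArg (of D).symm hst
    simp only [map_add, map_sub, map_mul, map_natCast, RingEquiv.symm_apply_apply] at h1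
    rw [hq] at h1
    linear_combination -h1
  rw [hab]
  exact Ideal.add_mem _ (Ideal.mul_mem_right _ _ (Ideal.subset_span (by simp))) (Ideal.mul_mem_right _ _ (Ideal.subset_span (by simp)))

end AinfRamTop

end Literature.NumberTheory.PAdicHodge

end
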